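import Summits.BirchSwinnertonDyer.BirchSwinnertonDyer.Theorems.PrintCf2RamifiedOffTYZLowerHalfVisibleSeven
import HarnessLib

/-!
# Crux workfile (line `offtyz-v7`, crux stmt-BirchSwinnertonDyer-20509) — TURNKEY ASIDE TEXT «RamifiedLowerHalfVisibleSevenDisplayOfFacts»
# (LEAD cruxlead-20509 g17, cycle 18): g16's visible-special lower half of C⁺ on the block-free family, restated with the TYZ display as an
# EXPLICIT PER-`n` HYPOTHESIS, so that the only named-fact antecedent is GZK (conjunct 1 of 𝔅_ram) — answers -plan g22's 04:31:17Z note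
# (aside rev 54 dropped at rev 55 because `tyz_cmPointCompositumData` is `cite_only`).

For the planner (route-A edit): paste the `def … : Prop :=` body below VERBATIM (name free, e.g. `RamifiedLowerHalfVisibleSevenDisplayOfFacts`)
into `Theses/PrintCf2.lean` (imports needed: `Literature.NumberTheory.EllipticCurves.TianYuanZhang2017.CMPointCompositumDisplays` for
`GenusPointData.CMPointCompositumPrinted` — already imported by rev 54's attempt).  Closer (after p762616 lands
`Theorems/PrintCf2RamifiedOffTYZLowerHalfVisibleSevenDisplay.lean`):
`theorem …_proof : …Theses.PrintCf2.<Name> := by unfold …<Name>; exact Summit.BirchSwinnertonDyer.PrintCf2.LowerHalfVisible.two_dvd_scriptL_of_visible_of_display`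
(or, without waiting for p762616, the 3-line term in the `example` below).  The hypothesis `∃ D : GenusPointData n, D.Printed ∧ D.CMPointCompositumPrinted`
is `tyz_cmPointCompositumData` specialised to `n` — the aside therefore closes NOW and stays meaningful: it becomes g16's `…OfFacts` form the hour
the fact is promoted (one `fun` away).  Nothing is asserted here beyond the `example`; BSD is not proved by any of this.
-/

noncomputable section

open WeierstrassCurve WeierstrassCurve.Affine Literature.NumberTheory.EllipticCurves
  Literature.NumberTheory.EllipticCurves.TianYuanZhang2017

namespace Summit.BirchSwinnertonDyer.PrintCf2.VisibleSevenAsideDisplay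

/-- The aside text (A_n = `(congruentNumberCurve n).twoIsogenyCodomain : Y² = X³ + 4n²X`; «generator modulo torsion» as in aside 23304;
«visible» = `X ∉ ℚ² ∪ 2ℚ²`; TYZ §3 display at `n` as a hypothesis). [cite: TianYuanZhang2017, §1 (p0002 L101–L110), §3.1 (p0011 L58–L66), Thm. 3.5] -/
def RamifiedLowerHalfVisibleSevenDisplayOfFactsText : Prop :=
  rank_eq_analyticRank_of_analyticRank_le_one →
    ∀ n : ℕ, (hsq : Squarefree n) → n % 8 = 7 → (∀ d ∈ n.divisors, d % 8 ≠ 5) →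
      (∃ D : GenusPointData n, D.Printed ∧ D.CMPointCompositumPrinted) →
      (haveI := isElliptic_congruentNumberCurve hsq.ne_zero; (congruentNumberCurve n).analyticRank = 1) →
      ∀ (X Y : ℚ) (h : ((congruentNumberCurve n).twoIsogenyCodomain).toAffine.Nonsingular X Y),
        (∀ P, ∃ m : ℤ, IsOfFinAddOrder
            (P - m • (Point.some X Y h : ((congruentNumberCurve n).twoIsogenyCodomain).toAffine.Point))) →
        (¬ ∃ q : ℚ, X = q ^ 2 ∨ X = 2 * q ^ 2) →
          ∀ L : ℤ, IsScriptL n L → (2 : ℤ) ∣ L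

/-- The text is closed by g16's landed display-level theorem (p760160). [cite: TianYuanZhang2017, Thm. 3.5] -/
example : RamifiedLowerHalfVisibleSevenDisplayOfFactsText :=
  fun hGZK _ hsq h7 hnb hD hr _ _ h hgen hX _ hL => by
    obtain ⟨D, hPr, hC⟩ := hD
    exact Summit.BirchSwinnertonDyer.PrintCf2.LowerHalfVisible.two_dvd_scriptL_of_visible_of_displays hGZK hsq h7 hnb hr D hPr hC h hgen hX hL

end Summit.BirchSwinnertonDyer.PrintCf2.VisibleSevenAsideDisplay

end
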